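import Summits.BirchSwinnertonDyer.BirchSwinnertonDyer.Theorems.SignedLowerHalvesSmallImageLowerHalfBothSignsRttCharRoadE1CartanQuotient
import Summits.BirchSwinnertonDyer.BirchSwinnertonDyer.Theorems.SignedLowerHalvesSmallImageLowerHalfBothSignsRttCharRoadE1MaschkeRetraction
import Summits.BirchSwinnertonDyer.BirchSwinnertonDyer.Theorems.SignedLowerHalvesSmallImageLowerHalfBothSignsRttCharRoadE1InjectivityCore
import Literature.NumberTheory.EllipticCurves.SelmerCorankAssembly
import Literature.NumberTheory.EllipticCurves.PeriodIndexCorestrictionLocal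
import HarnessLib

/-!
# Route `SignedLowerHalves`, crux L `SmallImageLowerHalfBothSigns` (stmt-BirchSwinnertonDyer-23599), line `rtt_w3` v12 — glue INPUT (I6) of the LEAD's composition
# `injTop_of_inputs` (INPUT SPEC 10:26:53Z): the JOINT INJECTIVITY ON CLASSES `hjoint` at `∞`-level, in brick D3-b's currency — for an `Sπ`-valued cocycle `φ`
# of `H ≤ Γ_K` (`H = Γ_{K_∞}`) on the `θ`-side module `M`, if every coordinate class `[s_l ∘ φ] ∈ H¹(H, W_K[p^∞])` vanishes then `[φ] = 0`.

Width seat `bsd-line-slh-p3-w3` g18 under LEAD `cruxlead-stmt-BirchSwinnertonDyer-23599` (cell `bsd-ssimc`; `--supports stmt-BirchSwinnertonDyer-23599 --as helper`).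
THEOREMS ONLY (no definition, no named fact, no instance, no `sorry`). GENERIC `M` (discrete `Γ_K`-module with commuting `R`-action), as in the spec. INPUTS kept as
hypotheses: `hsS` (global equivariance of the coordinates on `Sπ`, INPUT (I5)), `hsinj` (joint injectivity of the coordinates on `Sπ`, requested as an (I1) clause),
`hT0` (no non-zero `H`-fixed point of `W_K[p^∞]`), the stub's `(Φ, k, e₀, he₀, hk, h2, hKU)`. BSD / crux L / INJ_top are NOT proved here.

ROUTE. (1) `[s_l ∘ φ] = 0` in `H¹(H, W_K[p^∞])` ⟹ the `W_K[p]`-valued class vanishes (`ι_* : H¹(H, W_K[p]) → H¹(H, W_K[p^∞])` injective, LEAD p767920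
`resH1Hom_id_injective_of_torsionBy`, from `hT0`); (2) the product class in `H¹(H, Fin J → W_K[p])` vanishes (componentwise coboundaries); (3) Maschke (p768467
`exists_equivariant_retraction`, quotient `q = Φ ∘ ρ̄ ∘ res : H →* kˣ` of p768885, `p ∤ #kˣ`; `ker q` is trivial on `Sπ` BY `hsS` + `hsinj`) gives an equivariant
retraction `ρ` of `m ↦ (s_l m)_l`, and `φ = ρ ∘ Ψ = ∂(ρ b)`.

* ★★★ `oneCocycleClass_eq_zero_of_forall_comp_eq_zero` — `hjoint` VERBATIM (for any `H ≤ Γ_K`).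

References: [SerreLinearRepresentations1977] §1.3 Thm. 1; [SerreGaloisCohomology1997] I §5.1; [GreenbergVatsal2000] §2 p. 19; [Serre1972] §2.2.
-/

set_option autoImplicit false
set_option linter.dupNamespace false -- D-0017: single-problem summit, the namespace repeats the problem name by design
noncomputable section

open scoped Classical MatrixGroups

namespace Summit.BirchSwinnertonDyer.BirchSwinnertonDyer.Theorems.SmallImageCharSignedSelmer

open Literature.NumberTheory.GaloisRepresentations Literature.NumberTheory.GaloisRepresentations.Serre1972
  Literature.NumberTheory.EllipticCurves WeierstrassCurve Matrix

section Joint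

variable (K : Type) [Field K] [NumberField K] (W : WeierstrassCurve ℚ) {p : ℕ} [Fact p.Prime]
  (Φ : Multiplicative (AddAut (geomTorsion W p)) ≃* GL (Fin 2) (ZMod p))
  (k : Subalgebra (ZMod p) (Matrix (Fin 2) (Fin 2) (ZMod p))) (e₀ : geomTorsion W p ≃+ (Fin 2 → ZMod p))
  (he₀ : ∀ (g : Multiplicative (AddAut (geomTorsion W p))) (x : geomTorsion W p),
    e₀ (Multiplicative.toAdd g x) = ((Φ g : GL (Fin 2) (ZMod p)) : Matrix (Fin 2) (Fin 2) (ZMod p)) *ᵥ e₀ x)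
  {M : Type} [AddCommGroup M] [DistribMulAction (Field.absoluteGaloisGroup K) M] [TopologicalSpace M] [DiscreteTopology M]
  {R : Type*} [Ring R] [Module R M] [SMulCommClass (Field.absoluteGaloisGroup K) R M]

include he₀ in
/-- ★★★ **INPUT (I6) `hjoint`: joint injectivity on classes.** `H ≤ Γ_K` any subgroup (the spec: `κK.kerSubgroup`), `Sπ = M[π]` killed by `p`, no non-zero `H`-fixed point
in `TK = W_K[p^∞]` (`hT0`); coordinates `s : Fin J → (M →+ TK)` globally `Γ_K`-equivariant on `Sπ` (`hsS`) and jointly injective on `Sπ` (`hsinj`);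
`ρ̄(Γ_K) ⊆ kˣ` (`hKU`). Then an `Sπ`-valued continuous cocycle `φ` of `H` on `M` all of whose coordinate classes `[s_l ∘ φ] ∈ H¹(H, TK)` vanish has `[φ] = 0`.
[cite: SerreLinearRepresentations1977, §1.3 Thm. 1] [cite: SerreGaloisCohomology1997, I §5.1] [cite: GreenbergVatsal2000, §2 p. 19] -/
theorem oneCocycleClass_eq_zero_of_forall_comp_eq_zero (hk : IsField k) (h2 : Module.finrank (ZMod p) k = 2)
    (hKU : ∀ τ : Field.absoluteGaloisGroup K, Φ (galoisRepTorsion W p (absGaloisRestrict ℚ K τ)) ∈ unitGroup k)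
    (H : Subgroup (Field.absoluteGaloisGroup K)) (π : R) (Sπ : AddSubgroup M) (hSπ : ∀ m : M, m ∈ Sπ ↔ π • m = 0)
    (hpS : ∀ m : M, m ∈ Sπ → p • m = 0)
    (hT0 : ∀ t : (W.baseChange K).geomPrimaryTorsion p, (∀ x : H, (x : Field.absoluteGaloisGroup K) • t = t) → t = 0)
    {J : ℕ} (s : Fin J → (M →+ (W.baseChange K).geomPrimaryTorsion p))
    (hsS : ∀ (l : Fin J) (g : Field.absoluteGaloisGroup K) (m : M), m ∈ Sπ → s l (g • m) = g • s l m)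
    (hsinj : ∀ m : M, m ∈ Sπ → (∀ l : Fin J, s l m = 0) → m = 0)
    (φ : contOneCocycles (discreteTopRep H M)) (hφ : ∀ x : H, φ.1 x ∈ Sπ)
    (hzero : ∀ (l : Fin J) (ψ : contOneCocycles (discreteTopRep H ((W.baseChange K).geomPrimaryTorsion p))),
      (∀ x : H, ψ.1 x = s l (φ.1 x)) → oneCocycleClass _ ψ = 0) :
    oneCocycleClass _ φ = 0 := by
  -- abbreviations
  set incl : geomTorsion (W.baseChange K) p →+ (W.baseChange K).geomPrimaryTorsion p :=
    AddSubgroup.inclusion (geomTorsion_le_geomPrimaryTorsion (W.baseChange K) p) with hincl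
  have hincl_smul : ∀ (g : Field.absoluteGaloisGroup K) (Q : geomTorsion (W.baseChange K) p), incl (g • Q) = g • incl Q :=
    fun g Q ↦ Subtype.ext rfl
  have hincl_inj : Function.Injective incl := AddSubgroup.inclusion_injective _
  -- `Sπ` is `H`-stable (commuting actions)
  have hS : ∀ (x : H) (m : M), m ∈ Sπ → (x : Field.absoluteGaloisGroup K) • m ∈ Sπ := fun x m hm ↦ by
    rw [hSπ] at hm ⊢
    rw [← smul_comm (x : Field.absoluteGaloisGroup K) π m, hm, smul_zero]
  -- the values `s l m`, `m ∈ Sπ`, are `p`-torsion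
  have hsp : ∀ (l : Fin J) (m : M), m ∈ Sπ → ((s l m : (W.baseChange K).geomPrimaryTorsion p) : (W.baseChange K).geomPoints) ∈ geomTorsion (W.baseChange K) p := fun l m hm ↦ by
    rw [mem_geomTorsion_iff, natCast_zsmul]
    change (((p • s l m : (W.baseChange K).geomPrimaryTorsion p)) : (W.baseChange K).geomPoints) = 0
    rw [← map_nsmul, hpS m hm, map_zero]; rfl
  -- the coordinate maps into `W_K[p]` and the product map `ιA : Sπ → A := Fin J → W_K[p]`
  let sT : Fin J → (Sπ →+ geomTorsion (W.baseChange K) p) := fun l ↦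
    { toFun := fun m ↦ ⟨((s l (m : M) : (W.baseChange K).geomPrimaryTorsion p) : (W.baseChange K).geomPoints), hsp l m m.2⟩
      map_zero' := Subtype.ext (by
        change (((s l ((0 : Sπ) : M)) : (W.baseChange K).geomPrimaryTorsion p) : (W.baseChange K).geomPoints) = 0
        rw [AddSubgroup.coe_zero, map_zero]; rfl)
      map_add' := fun a b ↦ Subtype.ext (by
        change (((s l ((a + b : Sπ) : M)) : (W.baseChange K).geomPrimaryTorsion p) : (W.baseChange K).geomPoints) = _
        rw [AddSubgroup.coe_add, map_add]; rfl) }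
  have hsT : ∀ (l : Fin J) (m : Sπ), incl (sT l m) = s l (m : M) := fun l m ↦ Subtype.ext rfl
  let ιA : Sπ →+ (Fin J → geomTorsion (W.baseChange K) p) := AddMonoidHom.pi sT
  have hιA : ∀ (l : Fin J) (m : Sπ), ιA m l = sT l m := fun l m ↦ rfl
  have hιA_equiv : ∀ (x : H) (m : Sπ), ιA ⟨(x : Field.absoluteGaloisGroup K) • (m : M), hS x m m.2⟩ = (x : Field.absoluteGaloisGroup K) • ιA m := by
    intro x m
    funext l
    rw [Pi.smul_apply, hιA, hιA]
    apply hincl_inj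
    rw [hsT, hincl_smul, hsT]
    exact hsS l _ _ m.2
  have hιA_inj : Function.Injective ιA := by
    intro a b hab
    apply Subtype.ext
    rw [← sub_eq_zero]
    refine hsinj _ (Sπ.sub_mem a.2 b.2) fun l ↦ ?_
    rw [map_sub, sub_eq_zero, ← hsT, ← hsT, ← hιA, ← hιA, hab]
  -- (1)+(2): the product class `[ιA ∘ φ]` vanishes
  obtain ⟨Ψ, hΨ⟩ := exists_cocycle_comp Sπ hS ιA hιA_equiv φ hφ
  have hΨ0 : oneCocycleClass _ Ψ = 0 := by
    -- componentwise: the `W_K[p]`-valued classes vanish by the injectivity of `ι_*` on `H¹(H, ·)`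
    have hcomp : ∀ l : Fin J, ∃ b : geomTorsion (W.baseChange K) p, ∀ x : H, Ψ.1 x l = (x : Field.absoluteGaloisGroup K) • b - b := by
      intro l
      obtain ⟨ψ', hψ'⟩ := exists_cocycle_comp Sπ hS (sT l) (fun x m ↦ by
        apply hincl_inj; rw [hsT, hincl_smul, hsT]; exact hsS l _ _ m.2) φ hφ
      -- `ι_* [ψ'] = [s l ∘ φ] = 0`
      have hmap : resH1Hom (ContinuousMonoidHom.id H) incl (fun x a ↦ hincl_smul (x : Field.absoluteGaloisGroup K) a) (oneCocycleClass _ ψ') = 0 := by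
        rw [resH1Hom_oneCocycleClass]
        refine hzero l _ fun x ↦ ?_
        rw [pullback_resHomOfEquivariant_apply, hψ', hsT]; rfl
      have hinj := resH1Hom_id_injective_of_torsionBy (G := Field.absoluteGaloisGroup K) (H := H) incl
        (fun g a ↦ hincl_smul g a) hincl_inj p
        (fun a ↦ Subtype.ext (by
          change ((p : ℕ) • (a : (W.baseChange K).geomPoints)) = 0
          rw [← natCast_zsmul]; exact (mem_geomTorsion_iff _ _ _).1 a.2))
        (fun t ht ↦ ⟨⟨(t : (W.baseChange K).geomPoints), by
          rw [mem_geomTorsion_iff, natCast_zsmul]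
          change (((p • t : (W.baseChange K).geomPrimaryTorsion p)) : (W.baseChange K).geomPoints) = 0
          rw [ht]; rfl⟩, Subtype.ext rfl⟩)
        (fun t ht ↦ hT0 t fun x ↦ ht x)
      have h0 : oneCocycleClass _ ψ' = 0 := hinj (by rw [hmap, map_zero])
      rw [oneCocycleClass_eq_zero_iff] at h0
      obtain ⟨b, hb⟩ := h0
      refine ⟨b, fun x ↦ ?_⟩
      rw [hΨ, hιA, ← hψ']
      exact hb x
    choose b hb using hcomp
    rw [oneCocycleClass_eq_zero_iff]
    refine ⟨b, fun x ↦ ?_⟩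
    funext l
    rw [hb l x]
    rfl
  -- (3): Maschke retraction of `ιA`
  obtain ⟨q, hq, hqT, hqJ⟩ := exists_cartanQuotient_hom K W Φ k e₀ he₀ hKU H
  have hqA : ∀ x : H, q x = 1 → ∀ a : Fin J → geomTorsion (W.baseChange K) p, (x : Field.absoluteGaloisGroup K) • a = a :=
    fun x hx a ↦ hqJ x hx (Fin J) a
  have hqS : ∀ x : H, q x = 1 → ∀ m : M, m ∈ Sπ → (x : Field.absoluteGaloisGroup K) • m = m := by
    intro x hx m hm
    rw [← sub_eq_zero]
    refine hsinj _ (Sπ.sub_mem (hS x m hm) hm) fun l ↦ ?_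
    rw [map_sub, sub_eq_zero, hsS l _ m hm]
    -- `x` acts trivially on the `p`-torsion value `s l m`
    have h := hqT x hx ⟨((s l m : (W.baseChange K).geomPrimaryTorsion p) : (W.baseChange K).geomPoints), hsp l m hm⟩
    have h' := congrArg incl h
    have e : incl ⟨((s l m : (W.baseChange K).geomPrimaryTorsion p) : (W.baseChange K).geomPoints), hsp l m hm⟩ = s l m := Subtype.ext rfl
    rw [hincl_smul, e] at h'
    exact h'
  have hpA : ∀ a : Fin J → geomTorsion (W.baseChange K) p, p • a = 0 := fun a ↦ by
    funext l
    rw [Pi.smul_apply, Pi.zero_apply]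
    exact Subtype.ext (by
      change ((p : ℕ) • (a l : (W.baseChange K).geomPoints)) = 0
      rw [← natCast_zsmul]; exact (mem_geomTorsion_iff _ _ _).1 (a l).2)
  obtain ⟨ρ, hρ, hρι⟩ := exists_equivariant_retraction (G := Field.absoluteGaloisGroup K) (H := H) Sπ hS ιA hιA_equiv q
    (not_dvd_card_unitGroup hk h2) hpA (fun m ↦ Subtype.ext (hpS m m.2)) hqA hqS hιA_inj
  -- conclusion: `φ = ρ ∘ Ψ = ∂(ρ b)`
  rw [oneCocycleClass_eq_zero_iff] at hΨ0 ⊢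
  obtain ⟨a, ha⟩ := hΨ0
  refine ⟨ρ a, fun x ↦ ?_⟩
  have e1 : φ.1 x = ρ (ιA ⟨φ.1 x, hφ x⟩) := (hρι ⟨φ.1 x, hφ x⟩).symm
  have hax : Ψ.1 x = (x : Field.absoluteGaloisGroup K) • a - a := ha x
  change φ.1 x = (x : Field.absoluteGaloisGroup K) • ρ a - ρ a
  rw [e1, ← hΨ, hax, map_sub, hρ]

end Joint

end Summit.BirchSwinnertonDyer.BirchSwinnertonDyer.Theorems.SmallImageCharSignedSelmer

end
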